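import Mathlib.Analysis.Convex.Integral
import Mathlib.Analysis.Convex.SpecificFunctions.Basic
import Mathlib.Analysis.Convex.Mul
import Mathlib.Analysis.SpecialFunctions.Pow.Continuity
import Mathlib.Analysis.SpecialFunctions.Pow.Real
import Mathlib.MeasureTheory.Integral.IntervalIntegral.Basic
import Mathlib.MeasureTheory.Integral.Average
import HarnessLib

/-!
# Tsang's moment-comparison lemma (Tsang 1986, Lemma 4)

K.-M. Tsang, *Some `Ω`-theorems for the Riemann zeta-function*, Acta Arith. **46** (1986),
Lemma 4 (p. 376) — "the key idea that leads to the improved `Ω`-results":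

> Let `k` be a positive integer and let `W(t)` and `R(t)` be real valued functions satisfying
> (i) `∫_T^{2T} W(t)^{2k} dt ≥ T M₁^{2k}`, (ii) `|∫_T^{2T} W(t)^{2k+1} dt| ≤ ½ T M₁^{2k+1}`,
> (iii) `∫_T^{2T} |R(t)|^{2k+1} dt ≤ T M₂^{2k+1}`, (iv) `M₁ ≥ 2 M₂`. Then
> `sup_{t ∈ [T,2T]} ±{W(t) + R(t)} ≥ ½ M₁ - M₂`.

Everything in this file is PROVED (`Tsang1986_lemma4`). It is the purely real-variable step of the
proof of Tsang's Theorem 1 (`S(t) = Ω±((log t/log log t)^{1/3})`), which sharpens Selberg's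
Theorem 9 of 1946, the named fact `Literature.NumberTheory.LFunctions.Selberg1946_zetaArgS_omega`
of `SelbergArgOmega.lean` (whose last section proves the reduction of Selberg's statement to the
localized large-values statement that Lemma 4 delivers). In the application (Tsang §3) `W` is the
prime trigonometric polynomial `Im ∑_{p ≤ (log T)²} (1 - log p/(2 log log T)) p^{-1/2-it}` coming
from the convolution of `log ζ(1/2 + i(t+u))` with a Fejér-type kernel (his Lemma 5), `R` is the
contribution of the zeros off the critical line (controlled in `(2k+1)`-th mean by Selberg's
zero-density theorem, his Lemma 6), `M₁ = c√k` and `k ≍ (log T/log log T)^{2/3}`; the lemma is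
also the common final step of his Theorems 2, 3, 5 and 6.

## Statement as formalised

`W`, `R` are assumed continuous on `[T, 2T]` and `T > 0`, `M₁ > 0` (tacit in the source, where the
integrals are assumed to exist and `M₁ = c√k`; with Lean's Bochner integral a non-integrable
`|R|^{2k+1}` would make (iii) vacuous). The conclusion is printed as
`∃ t ∈ [T, 2T], ½ M₁ - M₂ ≤ W t + R t` (and the same for `-(W + R)`), which for continuous `W + R` on
the compact interval is the same as the `sup` form.

## Proof

Tsang's argument, reorganised to avoid dividing by `M₃ - M₂`: with `m = 2k + 1` and
`W₊ = max(W, 0)`, (i) and the power-mean inequality give `∫|W|^m ≥ T M₁^m`; since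
`W₊^m = (|W|^m + W^m)/2` for odd `m`, (ii) gives `∫ W₊^m ≥ ¼ T M₁^m = T M₃^m` with
`M₃ = 4^{-1/m} M₁ > ½ M₁ ≥ M₂`. If `W + R < M₃ - M₂ =: δ` on all of `[T, 2T]`, then
`W₊ + η ≤ |R| + δ` for some `η > 0` (compactness), and integrating
`(W₊ + η)^m ≥ W₊^m + η^m` against the two-point convexity bound
`(|R| + δ)^m ≤ |R|^m/λ^{m-1} + δ^m/(1-λ)^{m-1}`, `λ = M₂/M₃`, yields
`T(M₃^m + η^m) ≤ T M₂ M₃^{m-1} + T δ M₃^{m-1} = T M₃^m`, a contradiction. (The case `M₂ = 0` is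
reduced to `M₂ > 0` by enlarging `M₂` to `M₃ - ½M₁ > 0`.)

## References

* [Tsang1986] K.-M. Tsang, Acta Arith. 46 (1986), 369–395, Lemma 4 (pp. 376–378).
-/

noncomputable section

open Real Set MeasureTheory

namespace Literature.NumberTheory.LFunctions

namespace Tsang1986

/-! ### Real-variable helpers -/

/-- Jensen / power-mean inequality on an interval: for `f ≥ 0` continuous on `[a, b]` (`a < b`)
and `1 ≤ r`, `((b-a)⁻¹ ∫_{[a,b]} f)^r ≤ (b-a)⁻¹ ∫_{[a,b]} f^r`. [folklore] -/
theorem rpow_average_le {a b : ℝ} (hab : a < b) {f : ℝ → ℝ} (hf : ContinuousOn f (Icc a b))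
    (h0 : ∀ x ∈ Icc a b, 0 ≤ f x) {r : ℝ} (hr : 1 ≤ r) :
    ((b - a)⁻¹ * ∫ x in Icc a b, f x) ^ r ≤ (b - a)⁻¹ * ∫ x in Icc a b, f x ^ r := by
  have hr0 : 0 ≤ r := zero_le_one.trans hr
  have hvol : volume (Icc a b) = ENNReal.ofReal (b - a) := Real.volume_Icc
  have hne : volume (Icc a b) ≠ 0 := by
    rw [hvol]; exact (ENNReal.ofReal_pos.2 (sub_pos.2 hab)).ne'
  have htop : volume (Icc a b) ≠ ⊤ := by rw [hvol]; exact ENNReal.ofReal_ne_top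
  have hfs : ∀ᵐ x ∂(volume.restrict (Icc a b)), f x ∈ Ici (0 : ℝ) :=
    ae_restrict_of_forall_mem measurableSet_Icc fun x hx => h0 x hx
  have hgi : IntegrableOn ((fun x : ℝ => x ^ r) ∘ f) (Icc a b) volume :=
    (hf.rpow_const fun x _ => Or.inr hr0).integrableOn_Icc
  have hJ := ConvexOn.map_set_average_le (μ := volume) (t := Icc a b) (f := f)
    (convexOn_rpow hr) ((Real.continuous_rpow_const hr0).continuousOn) isClosed_Ici hne htop hfs
    hf.integrableOn_Icc hgi
  have hreal : volume.real (Icc a b) = b - a := by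
    rw [measureReal_def, hvol, ENNReal.toReal_ofReal (sub_pos.2 hab).le]
  rw [setAverage_eq, setAverage_eq, hreal, smul_eq_mul, smul_eq_mul] at hJ
  exact hJ

/-- Power-mean inequality for natural exponents `0 < p ≤ q`: for `f ≥ 0` continuous on `[a, b]`,
`((b-a)⁻¹ ∫ f^p)^{q/p} ≤ (b-a)⁻¹ ∫ f^q`. [folklore] -/
theorem rpow_average_pow_le {a b : ℝ} (hab : a < b) {f : ℝ → ℝ} (hf : ContinuousOn f (Icc a b))
    (h0 : ∀ x ∈ Icc a b, 0 ≤ f x) {p q : ℕ} (hp : 0 < p) (hpq : p ≤ q) :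
    ((b - a)⁻¹ * ∫ x in Icc a b, f x ^ p) ^ ((q : ℝ) / p) ≤ (b - a)⁻¹ * ∫ x in Icc a b, f x ^ q := by
  have hp0 : (0 : ℝ) < p := Nat.cast_pos.2 hp
  have hr : (1 : ℝ) ≤ (q : ℝ) / p := by
    rw [le_div_iff₀ hp0, one_mul]; exact_mod_cast hpq
  have h := rpow_average_le hab (f := fun x => f x ^ p) (hf.pow p)
    (fun x hx => pow_nonneg (h0 x hx) p) hr
  have hpt : ∀ x ∈ Icc a b, (f x ^ p) ^ ((q : ℝ) / p) = f x ^ q := fun x hx => by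
    rw [← Real.rpow_natCast (f x) p, ← Real.rpow_mul (h0 x hx), mul_div_cancel₀ _ hp0.ne',
      Real.rpow_natCast]
  rwa [setIntegral_congr_fun measurableSet_Icc hpt] at h

/-- Two-point convexity of `x ↦ x^n` on `[0, ∞)`: for `a, b ≥ 0`, `0 < l < 1` and `n ≥ 1`,
`(a + b)^n ≤ a^n / l^{n-1} + b^n / (1-l)^{n-1}` (apply convexity to `a/l`, `b/(1-l)` with weights
`l`, `1-l`). [folklore] -/
theorem add_pow_le_div_add_div {a b l : ℝ} (ha : 0 ≤ a) (hb : 0 ≤ b) (hl : 0 < l) (hl1 : l < 1)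
    {n : ℕ} (hn : 1 ≤ n) : (a + b) ^ n ≤ a ^ n / l ^ (n - 1) + b ^ n / (1 - l) ^ (n - 1) := by
  obtain ⟨m, rfl⟩ : ∃ m, n = m + 1 := ⟨n - 1, by omega⟩
  have hl1' : 0 < 1 - l := sub_pos.2 hl1
  have hcvx := (convexOn_pow (m + 1)).2 (mem_Ici.2 (div_nonneg ha hl.le))
    (mem_Ici.2 (div_nonneg hb hl1'.le)) hl.le hl1'.le (by ring : l + (1 - l) = 1)
  simp only [smul_eq_mul] at hcvx
  have e1 : l * (a / l) + (1 - l) * (b / (1 - l)) = a + b := by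
    field_simp
  have e2 : l * (a / l) ^ (m + 1) = a ^ (m + 1) / l ^ (m + 1 - 1) := by
    rw [Nat.add_sub_cancel, div_pow, pow_succ l m]
    field_simp
  have e3 : (1 - l) * (b / (1 - l)) ^ (m + 1) = b ^ (m + 1) / (1 - l) ^ (m + 1 - 1) := by
    rw [Nat.add_sub_cancel, div_pow, pow_succ (1 - l) m]
    field_simp
  rw [e1, e2, e3] at hcvx
  exact hcvx

/-- For odd `n`, the positive part satisfies `max(w,0)^n = (|w|^n + w^n)/2`. [folklore] -/
theorem max_zero_pow_eq_of_odd (w : ℝ) {n : ℕ} (hn : Odd n) :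
    (max w 0) ^ n = (|w| ^ n + w ^ n) / 2 := by
  rcases le_or_gt 0 w with hw | hw
  · rw [max_eq_left hw, abs_of_nonneg hw]; ring
  · rw [max_eq_right hw.le, abs_of_neg hw, hn.neg_pow, zero_pow hn.pos.ne']; ring

/-- The real volume of `[T, 2T]` is `T` for `T ≥ 0`. [folklore] -/
theorem volume_real_Icc_two_mul {T : ℝ} (hT : 0 ≤ T) : volume.real (Icc T (2 * T)) = T := by
  rw [measureReal_def, Real.volume_Icc, ENNReal.toReal_ofReal (by linarith)]
  ring

/-- The core of Tsang's argument (the `+` direction): if `∫_{[T,2T]} W₊^m ≥ T M₃^m`,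
`∫_{[T,2T]} |R|^m ≤ T M₂^m` and `0 < M₂ < M₃`, then `W + R ≥ M₃ - M₂` somewhere on `[T, 2T]`.
[cite: Tsang1986, Lemma 4 (proof, pp. 377–378)] -/
theorem exists_le_add_of_moments {T : ℝ} (hT : 0 < T) {m : ℕ} (hm : 1 ≤ m) {W R : ℝ → ℝ}
    (hW : ContinuousOn W (Icc T (2 * T))) (hR : ContinuousOn R (Icc T (2 * T))) {M₂ M₃ : ℝ}
    (hM₂ : 0 < M₂) (h23 : M₂ < M₃)
    (hWm : T * M₃ ^ m ≤ ∫ t in Icc T (2 * T), (max (W t) 0) ^ m)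
    (hRm : ∫ t in Icc T (2 * T), |R t| ^ m ≤ T * M₂ ^ m) :
    ∃ t ∈ Icc T (2 * T), M₃ - M₂ ≤ W t + R t := by
  by_contra! hlt
  set δ := M₃ - M₂ with hδdef
  have hδ : 0 < δ := sub_pos.2 h23
  have hM₃ : 0 < M₃ := hM₂.trans h23
  have hT2 : T ≤ 2 * T := by linarith
  have hIc : IsCompact (Icc T (2 * T)) := isCompact_Icc
  have hIne : (Icc T (2 * T)).Nonempty := nonempty_Icc.2 hT2
  -- the positive part `P = W₊` and `Q = |R|`
  set P : ℝ → ℝ := fun t => max (W t) 0 with hPdef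
  set Q : ℝ → ℝ := fun t => |R t| with hQdef
  have hPc : ContinuousOn P (Icc T (2 * T)) := hW.sup continuousOn_const
  have hQc : ContinuousOn Q (Icc T (2 * T)) := hR.abs
  have hP0 : ∀ t, 0 ≤ P t := fun t => le_max_right _ _
  have hQ0 : ∀ t, 0 ≤ Q t := fun t => abs_nonneg _
  -- a uniform gap `η > 0`: `P + η ≤ Q + δ` on the interval
  have hgc : ContinuousOn (fun t => Q t + δ - P t) (Icc T (2 * T)) := by fun_prop
  obtain ⟨t₀, ht₀, hmin⟩ := hIc.exists_isMinOn hIne hgc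
  set η := Q t₀ + δ - P t₀ with hηdef
  have hη : 0 < η := by
    have h := hlt t₀ ht₀
    show 0 < |R t₀| + δ - max (W t₀) 0
    rcases le_or_gt 0 (W t₀) with hw | hw
    · rw [max_eq_left hw]
      have := neg_abs_le (R t₀)
      linarith
    · rw [max_eq_right hw.le]
      linarith [abs_nonneg (R t₀)]
  have hpt : ∀ t ∈ Icc T (2 * T), P t + η ≤ Q t + δ := fun t ht => by
    have := isMinOn_iff.1 hmin t ht
    linarith
  -- integrability of everything in sight
  have cP : ContinuousOn (fun t => P t ^ m) (Icc T (2 * T)) := by fun_prop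
  have cPm : ContinuousOn (fun t => P t ^ m + η ^ m) (Icc T (2 * T)) := by fun_prop
  have cPη : ContinuousOn (fun t => (P t + η) ^ m) (Icc T (2 * T)) := by fun_prop
  have cQδ : ContinuousOn (fun t => (Q t + δ) ^ m) (Icc T (2 * T)) := by fun_prop
  have iP : IntegrableOn (fun t => P t ^ m) (Icc T (2 * T)) := cP.integrableOn_Icc
  have iPm : IntegrableOn (fun t => P t ^ m + η ^ m) (Icc T (2 * T)) := cPm.integrableOn_Icc
  have iPη : IntegrableOn (fun t => (P t + η) ^ m) (Icc T (2 * T)) := cPη.integrableOn_Icc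
  have iQδ : IntegrableOn (fun t => (Q t + δ) ^ m) (Icc T (2 * T)) := cQδ.integrableOn_Icc
  set l := M₂ / M₃ with hldef
  have hl : 0 < l := div_pos hM₂ hM₃
  have hl1 : l < 1 := (div_lt_one hM₃).2 h23
  have cQm : ContinuousOn (fun t => Q t ^ m) (Icc T (2 * T)) := by fun_prop
  have cQd : ContinuousOn (fun t => Q t ^ m / l ^ (m - 1)) (Icc T (2 * T)) := by fun_prop
  have cQl : ContinuousOn (fun t => Q t ^ m / l ^ (m - 1) + δ ^ m / (1 - l) ^ (m - 1))
      (Icc T (2 * T)) := by fun_prop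
  have iQm : IntegrableOn (fun t => Q t ^ m) (Icc T (2 * T)) := cQm.integrableOn_Icc
  have iQd : IntegrableOn (fun t => Q t ^ m / l ^ (m - 1)) (Icc T (2 * T)) := cQd.integrableOn_Icc
  have iQl : IntegrableOn (fun t => Q t ^ m / l ^ (m - 1) + δ ^ m / (1 - l) ^ (m - 1))
      (Icc T (2 * T)) := cQl.integrableOn_Icc
  have iηc : IntegrableOn (fun _ : ℝ => η ^ m) (Icc T (2 * T)) :=
    (continuousOn_const : ContinuousOn (fun _ : ℝ => η ^ m) (Icc T (2 * T))).integrableOn_Icc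
  have iδc : IntegrableOn (fun _ : ℝ => δ ^ m / (1 - l) ^ (m - 1)) (Icc T (2 * T)) :=
    (continuousOn_const :
      ContinuousOn (fun _ : ℝ => δ ^ m / (1 - l) ^ (m - 1)) (Icc T (2 * T))).integrableOn_Icc
  -- the chain of integral inequalities
  have hA : ∫ t in Icc T (2 * T), (P t ^ m + η ^ m) =
      (∫ t in Icc T (2 * T), P t ^ m) + T * η ^ m := by
    have h := integral_add iP iηc
    rw [h, setIntegral_const, volume_real_Icc_two_mul hT.le, smul_eq_mul]
  have hB : ∫ t in Icc T (2 * T), (P t ^ m + η ^ m) ≤ ∫ t in Icc T (2 * T), (P t + η) ^ m :=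
    setIntegral_mono_on iPm iPη measurableSet_Icc fun t _ =>
      pow_add_pow_le (hP0 t) hη.le (by omega)
  have hC : ∫ t in Icc T (2 * T), (P t + η) ^ m ≤ ∫ t in Icc T (2 * T), (Q t + δ) ^ m :=
    setIntegral_mono_on iPη iQδ measurableSet_Icc fun t ht =>
      pow_le_pow_left₀ (by linarith [hP0 t]) (hpt t ht) m
  have hD : ∫ t in Icc T (2 * T), (Q t + δ) ^ m ≤
      ∫ t in Icc T (2 * T), (Q t ^ m / l ^ (m - 1) + δ ^ m / (1 - l) ^ (m - 1)) :=
    setIntegral_mono_on iQδ iQl measurableSet_Icc fun t _ =>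
      add_pow_le_div_add_div (hQ0 t) hδ.le hl hl1 hm
  have hE : ∫ t in Icc T (2 * T), (Q t ^ m / l ^ (m - 1) + δ ^ m / (1 - l) ^ (m - 1)) =
      (∫ t in Icc T (2 * T), Q t ^ m) / l ^ (m - 1) + T * (δ ^ m / (1 - l) ^ (m - 1)) := by
    have h := integral_add iQd iδc
    rw [h, integral_div, setIntegral_const, volume_real_Icc_two_mul hT.le, smul_eq_mul]
  have hF : (∫ t in Icc T (2 * T), Q t ^ m) / l ^ (m - 1) ≤ T * M₂ ^ m / l ^ (m - 1) :=
    div_le_div_of_nonneg_right hRm (pow_nonneg hl.le _)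
  -- the algebraic identity `T M₂^m / l^{m-1} + T δ^m/(1-l)^{m-1} = T M₃^m`
  have hG : T * M₂ ^ m / l ^ (m - 1) + T * (δ ^ m / (1 - l) ^ (m - 1)) = T * M₃ ^ m := by
    obtain ⟨n, rfl⟩ : ∃ n, m = n + 1 := ⟨m - 1, by omega⟩
    have h1l : 1 - l = δ / M₃ := by
      rw [hldef, hδdef]; field_simp
    rw [Nat.add_sub_cancel, h1l, hldef, div_pow, div_pow]
    field_simp
    rw [hδdef]
    ring
  -- put everything together: `T η^m ≤ 0`
  have hchain : T * M₃ ^ m + T * η ^ m ≤ T * M₃ ^ m := by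
    calc T * M₃ ^ m + T * η ^ m
        ≤ (∫ t in Icc T (2 * T), P t ^ m) + T * η ^ m := by linarith
      _ = ∫ t in Icc T (2 * T), (P t ^ m + η ^ m) := hA.symm
      _ ≤ (∫ t in Icc T (2 * T), Q t ^ m) / l ^ (m - 1) + T * (δ ^ m / (1 - l) ^ (m - 1)) := by
          linarith
      _ ≤ T * M₂ ^ m / l ^ (m - 1) + T * (δ ^ m / (1 - l) ^ (m - 1)) := by linarith
      _ = T * M₃ ^ m := hG
  have : 0 < T * η ^ m := mul_pos hT (pow_pos hη m)
  linarith

/-- The `+` half of Tsang's Lemma 4 (continuous `W`, `R` on `[T, 2T]`, `T > 0`, `M₁ > 0`).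
[cite: Tsang1986, Lemma 4] -/
theorem lemma4_pos {k : ℕ} (hk : 1 ≤ k) {T M₁ M₂ : ℝ} (hT : 0 < T) (hM₁ : 0 < M₁)
    {W R : ℝ → ℝ} (hW : ContinuousOn W (Icc T (2 * T))) (hR : ContinuousOn R (Icc T (2 * T)))
    (h1 : T * M₁ ^ (2 * k) ≤ ∫ t in T..2 * T, W t ^ (2 * k))
    (h2 : |∫ t in T..2 * T, W t ^ (2 * k + 1)| ≤ T * M₁ ^ (2 * k + 1) / 2)
    (h3 : ∫ t in T..2 * T, |R t| ^ (2 * k + 1) ≤ T * M₂ ^ (2 * k + 1))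
    (h4 : 2 * M₂ ≤ M₁) :
    ∃ t ∈ Icc T (2 * T), M₁ / 2 - M₂ ≤ W t + R t := by
  have hT2 : T ≤ 2 * T := by linarith
  have hTI : T < 2 * T := by linarith
  -- interval integrals are integrals over `Icc T (2T)`
  have e : ∀ f : ℝ → ℝ, ∫ t in T..2 * T, f t = ∫ t in Icc T (2 * T), f t := fun f => by
    rw [intervalIntegral.integral_of_le hT2, integral_Icc_eq_integral_Ioc]
  rw [e] at h1 h2 h3
  set m := 2 * k + 1 with hmdef
  have hm1 : 1 ≤ m := by omega
  have hm3 : 3 ≤ m := by omega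
  have hmodd : Odd m := ⟨k, rfl⟩
  have hm0 : (m : ℝ) ≠ 0 := by positivity
  -- Step 1: `∫ |W|^m ≥ T M₁^m` (power mean)
  have hWa : ContinuousOn (fun t => |W t|) (Icc T (2 * T)) := hW.abs
  have hpm := rpow_average_pow_le hTI hWa (fun t _ => abs_nonneg _) (p := 2 * k) (q := m)
    (by omega) (by omega)
  have h2T : (2 * T - T)⁻¹ = T⁻¹ := by ring_nf
  rw [h2T] at hpm
  have hev : ∀ t, |W t| ^ (2 * k) = W t ^ (2 * k) := fun t => Even.pow_abs ⟨k, two_mul k⟩ _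
  simp_rw [hev] at hpm
  have hX : T * M₁ ^ m ≤ ∫ t in Icc T (2 * T), |W t| ^ m := by
    -- `M₁^(2k) ≤ T⁻¹ ∫ W^(2k)`
    have ha : M₁ ^ (2 * k) ≤ T⁻¹ * ∫ t in Icc T (2 * T), W t ^ (2 * k) := by
      rw [le_inv_mul_iff₀ hT]; exact h1
    have hb : (M₁ ^ (2 * k)) ^ ((m : ℝ) / (2 * k : ℕ)) ≤
        (T⁻¹ * ∫ t in Icc T (2 * T), W t ^ (2 * k)) ^ ((m : ℝ) / (2 * k : ℕ)) :=
      Real.rpow_le_rpow (pow_nonneg hM₁.le _) ha (by positivity)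
    have hc : (M₁ ^ (2 * k)) ^ ((m : ℝ) / (2 * k : ℕ)) = M₁ ^ m := by
      have h2k : ((2 * k : ℕ) : ℝ) ≠ 0 := by positivity
      rw [← Real.rpow_natCast M₁ (2 * k), ← Real.rpow_mul hM₁.le, mul_div_cancel₀ _ h2k,
        Real.rpow_natCast]
    rw [hc] at hb
    have hd := hb.trans hpm
    rwa [le_inv_mul_iff₀ hT] at hd
  -- Step 2: `∫ W₊^m ≥ ¼ T M₁^m`
  have hPm : ∫ t in Icc T (2 * T), (max (W t) 0) ^ m =
      ((∫ t in Icc T (2 * T), |W t| ^ m) + ∫ t in Icc T (2 * T), W t ^ m) / 2 := by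
    simp_rw [max_zero_pow_eq_of_odd _ hmodd]
    have cWa : ContinuousOn (fun t => |W t| ^ m) (Icc T (2 * T)) := by fun_prop
    have cWm : ContinuousOn (fun t => W t ^ m) (Icc T (2 * T)) := by fun_prop
    have iWa : IntegrableOn (fun t => |W t| ^ m) (Icc T (2 * T)) := cWa.integrableOn_Icc
    have iWm : IntegrableOn (fun t => W t ^ m) (Icc T (2 * T)) := cWm.integrableOn_Icc
    have h := integral_add iWa iWm
    rw [integral_div, h]
  have hWm' : -(T * M₁ ^ m / 2) ≤ ∫ t in Icc T (2 * T), W t ^ m := by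
    have := (abs_le.1 h2).1; linarith
  have hP4 : T * M₁ ^ m / 4 ≤ ∫ t in Icc T (2 * T), (max (W t) 0) ^ m := by
    rw [hPm]; linarith
  -- `M₃ = 4^{-1/m} M₁`, with `M₃^m = M₁^m/4` and `M₁/2 < M₃`
  set c : ℝ := (1 / 4 : ℝ) ^ (m : ℝ)⁻¹ with hcdef
  have hc0 : 0 < c := Real.rpow_pos_of_pos (by norm_num) _
  have hcm : c ^ m = 1 / 4 := by
    rw [← Real.rpow_natCast c m, hcdef, ← Real.rpow_mul (by norm_num), inv_mul_cancel₀ hm0,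
      Real.rpow_one]
  have hchalf : 1 / 2 < c := by
    have h14 : (1 / 4 : ℝ) = (1 / 2) ^ (2 : ℝ) := by norm_num
    have h12 : (1 / 2 : ℝ) = (1 / 2) ^ (1 : ℝ) := (Real.rpow_one _).symm
    rw [hcdef, h14, ← Real.rpow_mul (by norm_num)]
    conv_lhs => rw [h12]
    apply Real.rpow_lt_rpow_of_exponent_gt (by norm_num) (by norm_num)
    rw [mul_inv_lt_iff₀ (by positivity)]
    have : (3 : ℝ) ≤ m := by exact_mod_cast hm3
    linarith
  set M₃ := c * M₁ with hM₃def
  have hM₃m : T * M₃ ^ m ≤ ∫ t in Icc T (2 * T), (max (W t) 0) ^ m := by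
    rw [hM₃def, mul_pow, hcm]; linarith
  have hM₃gt : M₁ / 2 < M₃ := by rw [hM₃def]; nlinarith
  -- `M₂ ≥ 0` from (iii)
  have hM₂ : 0 ≤ M₂ := by
    have hint : 0 ≤ ∫ t in Icc T (2 * T), |R t| ^ m :=
      setIntegral_nonneg measurableSet_Icc fun t _ => pow_nonneg (abs_nonneg _) _
    have : 0 ≤ M₂ ^ m := by
      by_contra hneg
      have hneg' : M₂ ^ m < 0 := lt_of_not_ge hneg
      have := mul_neg_of_pos_of_neg hT hneg'
      linarith
    exact hmodd.pow_nonneg_iff.1 this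
  rcases hM₂.eq_or_lt with hM₂0 | hM₂pos
  · -- `M₂ = 0`: enlarge to `M₂' = M₃ - M₁/2 > 0`
    have hM₂' : 0 < M₃ - M₁ / 2 := sub_pos.2 hM₃gt
    have h3' : ∫ t in Icc T (2 * T), |R t| ^ m ≤ T * (M₃ - M₁ / 2) ^ m := by
      refine h3.trans ?_
      rw [← hM₂0, zero_pow (by omega), mul_zero]
      positivity
    obtain ⟨t, ht, hle⟩ := exists_le_add_of_moments hT hm1 hW hR hM₂' (by linarith) hM₃m h3'
    exact ⟨t, ht, by rw [← hM₂0]; linarith⟩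
  · obtain ⟨t, ht, hle⟩ :=
      exists_le_add_of_moments hT hm1 hW hR hM₂pos (by linarith) hM₃m h3
    exact ⟨t, ht, by linarith⟩

end Tsang1986

/-- **Tsang 1986, Lemma 4** (moment comparison). Let `k ≥ 1`, `T > 0`, `M₁ > 0`, and let
`W, R : ℝ → ℝ` be continuous on `[T, 2T]` with
(i) `∫_T^{2T} W^{2k} ≥ T M₁^{2k}`, (ii) `|∫_T^{2T} W^{2k+1}| ≤ ½ T M₁^{2k+1}`,
(iii) `∫_T^{2T} |R|^{2k+1} ≤ T M₂^{2k+1}`, (iv) `M₁ ≥ 2 M₂`.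
Then `sup_{[T,2T]} (W + R) ≥ ½ M₁ - M₂` and `sup_{[T,2T]} -(W + R) ≥ ½ M₁ - M₂`, i.e. there are
`t, t' ∈ [T, 2T]` with `W(t) + R(t) ≥ ½ M₁ - M₂` and `-(W(t') + R(t')) ≥ ½ M₁ - M₂`.
[cite: Tsang1986, Lemma 4] -/
theorem Tsang1986_lemma4 {k : ℕ} (hk : 1 ≤ k) {T M₁ M₂ : ℝ} (hT : 0 < T) (hM₁ : 0 < M₁)
    {W R : ℝ → ℝ} (hW : ContinuousOn W (Icc T (2 * T))) (hR : ContinuousOn R (Icc T (2 * T)))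
    (h1 : T * M₁ ^ (2 * k) ≤ ∫ t in T..2 * T, W t ^ (2 * k))
    (h2 : |∫ t in T..2 * T, W t ^ (2 * k + 1)| ≤ T * M₁ ^ (2 * k + 1) / 2)
    (h3 : ∫ t in T..2 * T, |R t| ^ (2 * k + 1) ≤ T * M₂ ^ (2 * k + 1))
    (h4 : 2 * M₂ ≤ M₁) :
    (∃ t ∈ Icc T (2 * T), M₁ / 2 - M₂ ≤ W t + R t) ∧
    (∃ t ∈ Icc T (2 * T), M₁ / 2 - M₂ ≤ -(W t + R t)) := by
  refine ⟨Tsang1986.lemma4_pos hk hT hM₁ hW hR h1 h2 h3 h4, ?_⟩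
  -- apply the `+` half to `-W`, `-R`
  have h1' : T * M₁ ^ (2 * k) ≤ ∫ t in T..2 * T, (-W t) ^ (2 * k) := by
    simpa only [Even.neg_pow ⟨k, two_mul k⟩] using h1
  have h2' : |∫ t in T..2 * T, (-W t) ^ (2 * k + 1)| ≤ T * M₁ ^ (2 * k + 1) / 2 := by
    have hodd : Odd (2 * k + 1) := ⟨k, rfl⟩
    simpa only [hodd.neg_pow, intervalIntegral.integral_neg, abs_neg] using h2
  have h3' : ∫ t in T..2 * T, |(-R t)| ^ (2 * k + 1) ≤ T * M₂ ^ (2 * k + 1) := by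
    simpa only [abs_neg] using h3
  obtain ⟨t, ht, hle⟩ := Tsang1986.lemma4_pos hk hT hM₁ hW.neg hR.neg h1' h2' h3' h4
  simp only [Pi.neg_apply] at hle
  exact ⟨t, ht, by linarith⟩

end Literature.NumberTheory.LFunctions
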